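import Summits.BirchSwinnertonDyer.Rank1Residual.JET.KolyvaginClassSignUnconditional
import Summits.BirchSwinnertonDyer.BirchSwinnertonDyer.Theorems.GenusKolyvaginAtTwoGenusPrimitiveSupplyAtTwoKolyvaginClassAtTwo
import HarnessLib

/-!
# Route `GenusKolyvaginAtTwo`, LINE 6, KEY crux Q3 (inner statement of stmt-BirchSwinnertonDyer-22137):
# the SIGN of the concrete Kolyvagin class under complex conjugation AT `p = 2`,
# `τ_* c_M(n) = −w(E)·(−1)^{#primes of n} · c_M(n)` in `H¹(K, E_K[2^M])` (Gross 1991 Prop. 5.4) — UNCONDITIONAL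

Helper (seat `bsd-line-gk2-p3` g13; `--supports` the crux, closes nothing). The pair descent of LINE 6 reads Kolyvagin's
classes `c_M(n) ∈ H¹(K, E_K[2^M])` as classes over `ℚ` of `E` (sign `+`) or of the twin `E^{(d_K)}` (sign `−`) through this
lineage's `…EigenClassesFinite` (`existsUnique_resTorsion_eq_of_conjAct_eq`, `existsUnique_hPsiKT_resTorsion_eq_of_conjAct_eq_neg`);
the input is the `τ`-eigen property of `c_M(n)` — the fields `res_c₁` / `res_c₂` of `VisiblePairAtTwo.Input`. The tree has the sign
law for every ODD `p` (`JET.sign_conjAct_kolyvaginClass`, p-reader; Literature named fact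
`McCallum1991.sign_conjAct_kolyvaginClass` with `p ≠ 2`, discharged by `kdd-p1`): its only use of `p ≠ 2` is Gross's Lemma 4.3
"`E(K[m])[p] = 0`" (`RingClassNoTorsion.isAdmissible_pointsSubgroup`). At `p = 2` that admissibility is the lead's
`GenusKoly.isAdmissible_pointsSubgroup_two` (p-reader gk2-p1: `ρ̄_{E,2}` onto, `d_K` odd, Heegner hypothesis ⟹ `E(K[m])[2^M] = 0`).
Everything else in the JET assembly — Gross Prop. 5.3 at every divisor (`exists_mem_ringClassGal_isOfFinAddOrder_conj_sub_smul`),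
data at the divisors (`nonempty_kolyvaginHeegnerData_of_grossCM` with the two discharged CM facts), and Prop. 5.4 (2) for the
concrete classes (`conjAct_kolyvaginClass_eq_sign_smul_zhang`) — is prime-agnostic. Hence:

* `sign_conjAct_kolyvaginClass_two` — **for `E/ℚ` globally minimal with `ρ̄_{E,2}` onto, `K` imaginary quadratic with `d_K` odd,
  `d_K ∉ {−3, −4}`, every `p ∣ N_E` split in `K`, the non-trivial `τ ∈ Aut(K/ℚ)`, a frame `(Dt, β, ι)`, a square-free `n` whose
  prime factors are Zhang–Kolyvagin primes at `2` of index `≥ M ≥ 1`, and ANY datum `d` of conductor `n`: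
  `τ_* c_M(n) = (−w(E)·(−1)^{#primes of n}) • c_M(n)` in `H¹(K, E_K[2^M])`**, with the sign in `{±1}`;
* `exists_sign_conjAct_kolyvaginClass_two` — the `∃ e ∈ {±1}` form;
* `conjAct_kolyvaginClass_two_eq_self` / `conjAct_kolyvaginClass_two_eq_neg` — the two parities spelled out: for `w(E) = −1`
  (the member carrying the Heegner point in its `+` part) `c_M(n)` is `τ`-FIXED at even depth and `τ`-ANTI-fixed at odd depth,
  and the other way round for `w(E) = +1` — the shape consumed by `res_c₁` / `res_c₂`.

THEOREMS ONLY (no definition, no named fact, no `sorry`, standard axioms). Nothing about Kolyvagin's conjecture at `2` or BSD is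
asserted.

References: [GrossLMS1991] §5 (5.2), Prop. 5.3, Prop. 5.4 (1)–(2) (p. 243), §4 Lemma 4.3; [McCallumLMS1991] §4 (4.2), (5), §5
(p. 303: `c_M(n) ∈ H¹(K, E_{p^M})^{(−1)^r ε}`); [Kolyvagin1989Izv] §3; [Jetchev2008] §4.1.3.
-/

set_option autoImplicit false
set_option linter.dupNamespace false -- tree convention: `Summit.BirchSwinnertonDyer.BirchSwinnertonDyer.Theorems` (summit = sub-problem)

noncomputable section

open scoped Classical
open WeierstrassCurve Field NumberField IsDedekindDomain Finset
open Literature.NumberTheory.EllipticCurves Literature.NumberTheory.GaloisRepresentations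
open Literature.NumberTheory.EllipticCurves.KolyvaginCocycle Literature.NumberTheory.EllipticCurves.KolyvaginEuler
open Literature.NumberTheory.EllipticCurves.RingClassField Literature.NumberTheory.EllipticCurves.ModularForms
open Summit.BirchSwinnertonDyer.Rank1Residual.X11b Summit.BirchSwinnertonDyer.Rank1Residual.X11b.Three
open Summit.BirchSwinnertonDyer.Rank1Residual.X11b.KolyvaginTauEigen
open Summit.BirchSwinnertonDyer.Rank1Residual.JET

namespace Summit.BirchSwinnertonDyer.BirchSwinnertonDyer.Theorems.GenusExact.KolyvaginClassSign

variable {K : Type} [Field K] [NumberField K] {W : WeierstrassCurve ℚ}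

/-- **Gross 1991 Prop. 5.4 AT `p = 2`: `τ_* c_M(n) = −w(E)·(−1)^{#primes of n} · c_M(n)` in `H¹(K, E_K[2^M])`, unconditionally**
on the frames of route `GenusKolyvaginAtTwo` (`ρ̄_{E,2}` onto, `d_K` odd `∉ {−3, −4}`, Heegner hypothesis): the JET assembly
(`conjAct_kolyvaginClass_eq_sign_smul_zhang` fed with Prop. 5.3 at every divisor and data at the divisors) with the admissibility
`E(K[m]) ⊆ E(K̄)` for `2^M` supplied by `GenusKoly.isAdmissible_pointsSubgroup_two` instead of the odd-`p` Lemma 4.3.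
[cite: GrossLMS1991, §5 Prop. 5.3, Prop. 5.4 (p. 243) and §4 Lemma 4.3] [cite: McCallumLMS1991, §5 (p. 303)] -/
theorem sign_conjAct_kolyvaginClass_two [W.IsElliptic] [W.IsGloballyMinimal] [NeZero (W.conductorNorm ℤ)]
    (hK : IsImaginaryQuadratic K) (hD3 : NumberField.discr K ≠ -3) (hD4 : NumberField.discr K ≠ -4)
    (hodd : Odd (NumberField.discr K)) (hH : SatisfiesHeegnerHypothesis (W.conductorNorm ℤ) K)
    (hsurj : W.HasSurjectiveModNGaloisRep ((2 : ℤ) ^ 1))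
    (τ : K ≃ₐ[ℚ] K) (hτ : τ ≠ 1)
    (Dt : ModularParametrizationData W (W.conductorNorm ℤ)) (β : ℤ) (ι : K →+* ℂ)
    {n : ℕ} (hn : Squarefree n) {M : ℕ} (hM : 1 ≤ M)
    (hnK : ∀ ℓ ∈ n.primeFactors, Zhang2014.IsKolyvaginPrime (W.conductorNorm ℤ) W K 2 ℓ ∧
      M ≤ Zhang2014.kolyvaginIndex W 2 ℓ)
    (d : KolyvaginHeegnerData Dt β ι n) :
    (-W.rootNumber * (-1) ^ n.primeFactors.card = 1 ∨ -W.rootNumber * (-1) ^ n.primeFactors.card = -1) ∧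
      conjAct W τ ((2 ^ M : ℕ) : ℤ) (d.kolyvaginClass Nat.prime_two M) =
        (-W.rootNumber * (-1) ^ n.primeFactors.card) • d.kolyvaginClass Nat.prime_two M := by
  have hCM1 : phi_heegnerPointOfConductor_mem_range_map_ringClassField (W.conductorNorm ℤ) W K :=
    phi_heegnerPointOfConductor_mem_range_map_ringClassField_holds (W.conductorNorm ℤ) W K
  have hCM2 : exists_generator_ringClassGalOver K := exists_generator_ringClassGalOver_holds
  have hND : IsCoprime (W.conductorNorm ℤ : ℤ) (NumberField.discr K) :=
    KolyvaginAssembly.isCoprime_discr_of_satisfiesHeegnerHypothesis hK hH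
  have hD : NumberField.discr K < -4 := KolyvaginAssembly.discr_lt_neg_four hK ⟨hD3, hD4⟩
  have hinert : ∀ (m' : ℕ), m' ∣ n → ∀ q ∈ m'.primeFactors, (Ideal.span {(q : 𝓞 K)}).IsPrime :=
    fun m' hm' q hq ↦ (hnK q (Nat.primeFactors_mono hm' hn.ne_zero hq)).1.2.2.2.2.1
  -- data at every divisor of `n` (the given `d` at `n` itself)
  have hne : ∀ m' : ℕ, m' ∣ n → Nonempty (KolyvaginHeegnerData Dt β ι m') := fun m' hm' ↦
    BirchSwinnertonDyer.Theorems.nonempty_kolyvaginHeegnerData_of_grossCM hCM1 hCM2 hK hH Dt β ι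
      d.dvd_sq_sub (hn.squarefree_of_dvd hm') (hinert m' hm')
  let data : (m' : ℕ) → m' ∣ n → KolyvaginHeegnerData Dt β ι m' := fun m' hm' ↦
    if h : m' = n then h ▸ d else (hne m' hm').some
  have hdata : data n dvd_rfl = d := by simp [data]
  -- Gross Prop. 5.3 at every divisor of `n` (all `≠ 0` and prime to `N`), UNCONDITIONALLY
  have h53 : ∀ (m : ℕ) (hm : m ∣ n) (τm : ringClassField K ι m ≃ₐ[ℚ] ringClassField K ι m),
      (∀ x : ringClassField K ι m, ((τm x : ringClassField K ι m) : ℂ) = starRingEnd ℂ x) →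
      ∃ σ' ∈ ringClassGal ι m, IsOfFinAddOrder
        (pointGalHom W (ringClassField K ι m) τm (data m hm).y -
          (-W.rootNumber) • pointGalHom W (ringClassField K ι m) σ' (data m hm).y) := by
    intro m hm τm hτm
    obtain ⟨hm0, hmN⟩ := ne_zero_and_coprime_of_isKolyvaginPrime (K := K) (hn.squarefree_of_dvd hm)
      (fun q hq ↦ (hnK q (Nat.primeFactors_mono hm hn.ne_zero hq)).1)
    exact exists_mem_ringClassGal_isOfFinAddOrder_conj_sub_smul W hK hH Dt ι hm0 hmN (data m hm) τm hτm
  refine ⟨?_, ?_⟩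
  · rcases W.rootNumber_eq_one_or with h1 | h1 <;>
      rcases neg_one_pow_eq_or ℤ n.primeFactors.card with h | h <;> simp [h1, h]
  · -- the only `p = 2`-specific input: admissibility of `E(K[m]) ⊆ E(K̄)` for `2^M` (Lemma 4.3 at `2`)
    have h := conjAct_kolyvaginClass_eq_sign_smul_zhang (c := τ) hK ι Nat.prime_two hM Dt hND hD hn hnK data hτ
      (-W.rootNumber) h53
      (fun m hm ↦ GenusKoly.isAdmissible_pointsSubgroup_two hK hodd hH hsurj
        (ne_zero_of_dvd_ne_zero hn.ne_zero hm) (data m hm) M) n dvd_rfl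
    rwa [hdata] at h

/-- The same in the `∃ e ∈ {±1}` form. [cite: GrossLMS1991, §5 Prop. 5.4 (p. 243)] -/
theorem exists_sign_conjAct_kolyvaginClass_two [W.IsElliptic] [W.IsGloballyMinimal] [NeZero (W.conductorNorm ℤ)]
    (hK : IsImaginaryQuadratic K) (hD3 : NumberField.discr K ≠ -3) (hD4 : NumberField.discr K ≠ -4)
    (hodd : Odd (NumberField.discr K)) (hH : SatisfiesHeegnerHypothesis (W.conductorNorm ℤ) K)
    (hsurj : W.HasSurjectiveModNGaloisRep ((2 : ℤ) ^ 1))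
    (τ : K ≃ₐ[ℚ] K) (hτ : τ ≠ 1)
    (Dt : ModularParametrizationData W (W.conductorNorm ℤ)) (β : ℤ) (ι : K →+* ℂ)
    {n : ℕ} (hn : Squarefree n) {M : ℕ} (hM : 1 ≤ M)
    (hnK : ∀ ℓ ∈ n.primeFactors, Zhang2014.IsKolyvaginPrime (W.conductorNorm ℤ) W K 2 ℓ ∧
      M ≤ Zhang2014.kolyvaginIndex W 2 ℓ)
    (d : KolyvaginHeegnerData Dt β ι n) :
    ∃ e : ℤ, (e = 1 ∨ e = -1) ∧
      conjAct W τ ((2 ^ M : ℕ) : ℤ) (d.kolyvaginClass Nat.prime_two M) = e • d.kolyvaginClass Nat.prime_two M :=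
  ⟨_, sign_conjAct_kolyvaginClass_two hK hD3 hD4 hodd hH hsurj τ hτ Dt β ι hn hM hnK d⟩

/-- **Even sign: `c_M(n)` is `τ`-fixed** — when `−w(E)·(−1)^{#primes of n} = 1`, i.e. `w(E) = −1` and `n` has an even number of
prime factors, or `w(E) = +1` and an odd number: the class descends to `H¹(ℚ, E[2^M])` (`EigenClassesFinite.existsUnique_resTorsion_eq_of_conjAct_eq`).
[cite: GrossLMS1991, §5 Prop. 5.4] [cite: McCallumLMS1991, §5 (p. 303)] -/
theorem conjAct_kolyvaginClass_two_eq_self [W.IsElliptic] [W.IsGloballyMinimal] [NeZero (W.conductorNorm ℤ)]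
    (hK : IsImaginaryQuadratic K) (hD3 : NumberField.discr K ≠ -3) (hD4 : NumberField.discr K ≠ -4)
    (hodd : Odd (NumberField.discr K)) (hH : SatisfiesHeegnerHypothesis (W.conductorNorm ℤ) K)
    (hsurj : W.HasSurjectiveModNGaloisRep ((2 : ℤ) ^ 1))
    (τ : K ≃ₐ[ℚ] K) (hτ : τ ≠ 1)
    (Dt : ModularParametrizationData W (W.conductorNorm ℤ)) (β : ℤ) (ι : K →+* ℂ)
    {n : ℕ} (hn : Squarefree n) {M : ℕ} (hM : 1 ≤ M)
    (hnK : ∀ ℓ ∈ n.primeFactors, Zhang2014.IsKolyvaginPrime (W.conductorNorm ℤ) W K 2 ℓ ∧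
      M ≤ Zhang2014.kolyvaginIndex W 2 ℓ)
    (d : KolyvaginHeegnerData Dt β ι n) (hsign : -W.rootNumber * (-1) ^ n.primeFactors.card = 1) :
    conjAct W τ ((2 ^ M : ℕ) : ℤ) (d.kolyvaginClass Nat.prime_two M) = d.kolyvaginClass Nat.prime_two M := by
  have h := (sign_conjAct_kolyvaginClass_two hK hD3 hD4 hodd hH hsurj τ hτ Dt β ι hn hM hnK d).2
  rwa [hsign, one_smul] at h

/-- **Odd sign: `c_M(n)` is `τ`-anti-fixed** — when `−w(E)·(−1)^{#primes of n} = −1`: the class descends to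
`H¹(ℚ, E^{(d_K)}[2^M])` (`EigenClassesFinite.existsUnique_hPsiKT_resTorsion_eq_of_conjAct_eq_neg`). [cite: GrossLMS1991, §5 Prop. 5.4]
[cite: Kolyvagin1989Izv, §3 (the pair `(E, E^D)`)] -/
theorem conjAct_kolyvaginClass_two_eq_neg [W.IsElliptic] [W.IsGloballyMinimal] [NeZero (W.conductorNorm ℤ)]
    (hK : IsImaginaryQuadratic K) (hD3 : NumberField.discr K ≠ -3) (hD4 : NumberField.discr K ≠ -4)
    (hodd : Odd (NumberField.discr K)) (hH : SatisfiesHeegnerHypothesis (W.conductorNorm ℤ) K)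
    (hsurj : W.HasSurjectiveModNGaloisRep ((2 : ℤ) ^ 1))
    (τ : K ≃ₐ[ℚ] K) (hτ : τ ≠ 1)
    (Dt : ModularParametrizationData W (W.conductorNorm ℤ)) (β : ℤ) (ι : K →+* ℂ)
    {n : ℕ} (hn : Squarefree n) {M : ℕ} (hM : 1 ≤ M)
    (hnK : ∀ ℓ ∈ n.primeFactors, Zhang2014.IsKolyvaginPrime (W.conductorNorm ℤ) W K 2 ℓ ∧
      M ≤ Zhang2014.kolyvaginIndex W 2 ℓ)
    (d : KolyvaginHeegnerData Dt β ι n) (hsign : -W.rootNumber * (-1) ^ n.primeFactors.card = -1) :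
    conjAct W τ ((2 ^ M : ℕ) : ℤ) (d.kolyvaginClass Nat.prime_two M) = -d.kolyvaginClass Nat.prime_two M := by
  have h := (sign_conjAct_kolyvaginClass_two hK hD3 hD4 hodd hH hsurj τ hτ Dt β ι hn hM hnK d).2
  rwa [hsign, neg_one_zsmul] at h

end Summit.BirchSwinnertonDyer.BirchSwinnertonDyer.Theorems.GenusExact.KolyvaginClassSign

end
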